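import Summits.BirchSwinnertonDyer.BirchSwinnertonDyer.Theses.PrintCf2
import Summits.BirchSwinnertonDyer.BirchSwinnertonDyer.Theorems.PrintCf2RamifiedOffTYZThetaLeaf
import HarnessLib

/-!
# Route `PrintCf2`, aside `RamifiedThetaOfFactsPlus` — CLOSED: the theta-descent families of cell `bsd-monsky` (𝒮⁻-towers /
# stars and the three-prime shapes 557 / 377 / 355 / 157 / 135) from the ramified bundle PLUS TYZ Thm 1.1 and the §3.1–3.2
# CM-point display, BY NAME (cell `bsd-print-cf2`, p1)

HONEST FRAMING (cell `bsd-print-cf2`, run/shared/lean/pub/bsd-print-cf2/; route `PrintCf2`, leaf CornerF @ `p = 2` =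
`WAllCornerFTwo`, OPEN AS A CLASS): a CLOSING file — it imports the route file and proves ONE aside whose statement carries
its published inputs as an antecedent (facts-relative «OfFactsPlus» typing, K7t doctrine; nothing asserted, no named fact
introduced): `(𝔅_ram ∧ TianYuanZhang2017.thm11_parity_of_scriptL ∧ TianYuanZhang2017.tyz_cmPointGaloisData) →
Summit.BirchSwinnertonDyer.WAllCornerFTwoRamifiedTheta` (planner g3, on this seat's TURNKEY 17:07:35Z). The mathematics is
cell `bsd-monsky`'s (prover-B, `P2.ThetaDescent.*`), assembled in `Theorems/PrintCf2RamifiedOffTYZThetaLeaf.lean`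
(`PrintCf2.theta_of_bundlePlus`) over the leaf file `Rank1Residual/WAll/TargetCMTwoRamifiedTheta.lean` (p548609); here only
the one-line term. Booking currency: LITERAL-by-name(`tyz_cmPointGaloisData`). Beyond print: YES (Monsky 1990 p. 67
Remark (3) conjectures the two-prime case only). [cite: Monsky1990MockHeegner, p. 67 Remark (3)]
[cite: TianYuanZhang2017, Thm. 1.1, Thm. 3.5, Thm. 3.6] [cite: Miller2011LMS, §1 and Def. 1.1]
-/

noncomputable section

open scoped Classical

open Summit.BirchSwinnertonDyer
open Summit.BirchSwinnertonDyer.BirchSwinnertonDyer.Theses.PrintCf2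

set_option autoImplicit false
-- `Summit.BirchSwinnertonDyer.BirchSwinnertonDyer.Theorems` is the layout's namespace (Sub = Summit name).
set_option linter.dupNamespace false

namespace Summit.BirchSwinnertonDyer.BirchSwinnertonDyer.Theorems

/-- **Aside `RamifiedThetaOfFactsPlus` holds**: `𝔅_ram ∧ TYZ Thm 1.1 ∧ the CM-point display ⟹` the theta leaf, by
`PrintCf2.theta_of_bundlePlus`. [cite: TianYuanZhang2017, Thm. 1.1, Thm. 3.5, Thm. 3.6] [cite: Monsky1990MockHeegner, p. 67 Remark (3)] -/
theorem ramifiedThetaOfFactsPlus_proof : RamifiedThetaOfFactsPlus :=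
  fun h ↦ Summit.BirchSwinnertonDyer.PrintCf2.theta_of_bundlePlus h

end Summit.BirchSwinnertonDyer.BirchSwinnertonDyer.Theorems

end
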